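import Summits.CriticalPhenomena.PercolationContinuityZ3.Theorems.FK.OSSSSeedVariance
import Literature.Probability.Percolation.OneArmOSSSBox
import HarnessLib

/-!
# The lattice incidence on the edges of an inner box `Λ_n ⊂ ℤ^d` for the seed explorations of the spheres `∂Λ_k`
# (Duminil-Copin–Raoufi–Tassion 2019, §3, proof of Lemma 3.2 / Thm 1.2 — geometric set-up)

Claimed R42 (8)(c) in the cell INBOX at 2026-08-28T02:11:55Z by fkp-10a gen 352 (NEW CLAIM #2 of the gen), addressed to coordinator fk-4 g266 (seated 01:27Z 2026-08-28; R146 l.8252: row FO-10a-g352 = package g352-osss; its (κ) clause sends the FK instantiation to a new claim, R147); lineage row FO-10a-g352f (self-suggested), package g352-fkosss, label FS-B.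
Support file of the `fk-continuity` cell (lineage fkp-10a, `--supports stmt-CriticalPhenomena-4575`); builds on
p205010 (kernel theorem, internal audit signed; external expert review pending).  No definitions, no named facts,
no sorries; standard axioms.  Package `g352-fkosss` = THE FK INSTANTIATION of the OSSS inequality for monotonic measures
(row FO-10a-g352 `g352-osss`): Duminil-Copin–Raoufi–Tassion's Theorem 1.2 (sharpness of the random-cluster phase
transition on `ℤ^d`, `q ≥ 1`) and, on `ℤ²`, `p_c(q) = √q/(1+√q)`.  UNCONDITIONAL; nothing here touches FH / TP_FK / the
`_r3` binders of the cell.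

Geometric set-up of the FK instantiation of the OSSS inequality for monotonic measures (package `g352-fkosss`, after
`g352-osss`).  Coordinates `ι_n = edgesIn ℤ^d Λ_n` (lattice edges inside `Λ_n`, a subtype of `Sym2 (Site d)`), vertices
`BoxV d n = Λ_n`, and an incidence `edge : Λ_n → Λ_n → Option ι_n` PINNED by `edge a b = some e ↔ a ∼ b ∧ e = {a,b}` (a
variable with this characterisation — the consumer instantiates it; no definition here): symmetry (`edge_symm'`),
endpoint uniqueness (`edge_ends'`), open adjacency of the READ-OUT `ω ↦ (e ↦ [e ∈ ω])` (`yAdj_readout_iff`), the bridges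
between open paths of the read-out and open lattice paths inside `Λ_n` (`pathIn_of_yReach'`, `yReach_of_pathIn'`),
separation of `0` from `∂Λ_n` by the spheres `∂Λ_k`, `1 ≤ k ≤ n` (`separates_sphereSeed'`), the identification of
`𝟙{0 ↔ ∂Λ_n}` with the one-arm event `siteToBoundary` (`mem_siteToBoundary_of_conn'`, `conn_of_mem_siteToBoundary'`), and
"joined to `∂Λ_k` inside `Λ_n` ⟹ the translated arm event `armEvent u |k − ‖u‖_∞|`" (`armEvent_of_seedConn'`) — ports to
this incidence of the tree's `OneArmOSSSBox.lean` (written for the all-pairs cube `PairIdx` with biases `0` off the lattice,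
which a strictly positive monotonic weight cannot use).  No probability here.

## References
* H. Duminil-Copin, A. Raoufi, V. Tassion, Ann. of Math. 189 (2019) 75–99, §3 (proof of Thm 1.2: μ_n = φ^w_{Λ_{2n}},
  the trees of ∂Λ_k). [DuminilCopinRaoufiTassion2019]
* T. Hutchcroft, Probab. Math. Phys. 1 (2020), §2.3 (edge-labelled graphs, the incidence formalism). [Hutchcroft2020]
-/

namespace Summit.CriticalPhenomena.PercolationContinuityZ3.Theorems.FK

namespace MonotonicOSSS

open MeasureTheory Finset Function Literature.Probability.ODonnellSaksSchrammServedio2005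
open Literature.Probability.Percolation Literature.Probability.LatticeModels
open Literature.Probability.Percolation.GhostExploration Literature.Probability.Percolation.SeedExploration
open Literature.Probability.Percolation.OneArmOSSS Literature.Probability.Percolation.DCT16
open Classical

variable {d n : ℕ}

/-! ### The lattice incidence on `ι_n = edgesIn ℤ^d Λ_n` -/

section Incidence

variable (edge : BoxV d n → BoxV d n → Option ↥(edgesIn (zdGraph d) (box d n)))

/-- A lattice edge of `Λ_n` joins two vertices of `Λ_n`. [cite: DuminilCopinRaoufiTassion2019, §3 Lemma 3.2 (the finite graph G = (V,E))] -/
theorem mk_mem_edgesIn_box {a b : BoxV d n} (h : (zdGraph d).Adj a.1 b.1) :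
    s(a.1, b.1) ∈ edgesIn (zdGraph d) (box d n) := by
  rw [mem_edgesIn_iff]
  refine ⟨(SimpleGraph.mem_edgeSet _).2 h, fun x hx => ?_⟩
  rcases Sym2.mem_iff.1 hx with rfl | rfl
  · exact a.2
  · exact b.2

/-- Symmetry of the pinned incidence. [cite: DuminilCopinRaoufiTassion2019, §3 Lemma 3.2 (undirected graph)] -/
theorem edge_symm' (hedge : ∀ a b e, edge a b = some e ↔ (zdGraph d).Adj a.1 b.1 ∧ (e : Sym2 (Site d)) = s(a.1, b.1))
    (a b : BoxV d n) : edge a b = edge b a := by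
  have key : ∀ e, edge a b = some e ↔ edge b a = some e := fun e => by
    rw [hedge, hedge, Sym2.eq_swap]
    exact and_congr_left fun _ => ⟨fun h => h.symm, fun h => h.symm⟩
  cases hab : edge a b with
  | none =>
    cases hba : edge b a with
    | none => rfl
    | some e => exact absurd ((key e).2 hba) (by rw [hab]; simp)
  | some e => exact ((key e).1 hab).symm

/-- Endpoint uniqueness of the pinned incidence. [cite: DuminilCopinRaoufiTassion2019, §3 Lemma 3.2 (simple graph)] -/
theorem edge_ends' (hedge : ∀ a b e, edge a b = some e ↔ (zdGraph d).Adj a.1 b.1 ∧ (e : Sym2 (Site d)) = s(a.1, b.1))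
    (e : ↥(edgesIn (zdGraph d) (box d n))) (a b a' b' : BoxV d n) (h : edge a b = some e)
    (h' : edge a' b' = some e) : a' = a ∨ a' = b := by
  obtain ⟨_, h1⟩ := (hedge _ _ _).1 h
  obtain ⟨_, h2⟩ := (hedge _ _ _).1 h'
  rw [h1] at h2
  rcases Sym2.eq_iff.1 h2 with ⟨h3, _⟩ | ⟨h3, h4⟩
  · exact Or.inl (Subtype.ext h3.symm)
  · exact Or.inr (Subtype.ext h4.symm)

/-- Open adjacency of the read-out `e ↦ [e ∈ ω]` for the pinned incidence: a lattice step inside `Λ_n` along an open edge.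
[cite: DuminilCopinRaoufiTassion2019, §3 Lemma 3.2 (open edges)] -/
theorem yAdj_readout_iff (hedge : ∀ a b e, edge a b = some e ↔ (zdGraph d).Adj a.1 b.1 ∧ (e : Sym2 (Site d)) = s(a.1, b.1))
    (ω : BondConfig (Site d)) (a b : BoxV d n) :
    YAdj edge (fun e => decide (e.1 ∈ ω)) a b ↔ a ≠ b ∧ (zdGraph d).Adj a.1 b.1 ∧ s(a.1, b.1) ∈ ω := by
  unfold YAdj
  refine and_congr_right fun _ => ?_
  constructor
  · rintro ⟨e, he, hy⟩
    obtain ⟨hadj, he1⟩ := (hedge _ _ _).1 he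
    refine ⟨hadj, ?_⟩
    rw [← he1]; simpa using hy
  · rintro ⟨hadj, hω⟩
    refine ⟨⟨s(a.1, b.1), mk_mem_edgesIn_box hadj⟩, (hedge _ _ _).2 ⟨hadj, rfl⟩, ?_⟩
    simpa using hω

/-- THE SPHERES SEPARATE (pinned incidence): for `1 ≤ k ≤ n` every open path of the read-out from `0` to `∂Λ_n` meets
`∂Λ_k`. [cite: DuminilCopinRaoufiTassion2019, §3 proof of Lemma 3.2 (T determines 𝟙_{0↔∂Λ_n} for 1 ≤ k ≤ n)] -/
theorem separates_sphereSeed' (hedge : ∀ a b e, edge a b = some e ↔ (zdGraph d).Adj a.1 b.1 ∧ (e : Sym2 (Site d)) = s(a.1, b.1))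
    {k : ℕ} (hk1 : 1 ≤ k) (hkn : k ≤ n) :
    Separates edge (sphereSeed d n k) (origin d n) (bdryTarget d n) := by
  intro y b hb hob
  have hsymm := edge_symm' edge hedge
  have key : ∀ w : BoxV d n, YReach edge y (origin d n) w →
      boxNorm w.1 < k ∨ ∃ u ∈ sphereSeed d n k, YReach edge y u (origin d n) ∧ YReach edge y u w := by
    intro w hw
    unfold YReach at hw
    induction hw with
    | refl => left; change boxNorm (0 : Site d) < k; rw [boxNorm_zero]; omega
    | @tail v w hv hvw ih =>
      rcases ih with hlt | ⟨u, hu, huo, huv⟩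
      · obtain ⟨e, he, -⟩ := hvw.2
        obtain ⟨hadj, _⟩ := (hedge _ _ _).1 he
        have hstep := boxNorm_le_succ_of_adj hadj
        by_cases hwk : boxNorm w.1 < k
        · exact Or.inl hwk
        · right
          have hw : boxNorm w.1 = k := by omega
          refine ⟨w, hw, ?_, Relation.ReflTransGen.refl⟩
          exact yReach_symm hsymm (Relation.ReflTransGen.tail hv hvw)
      · right
        exact ⟨u, hu, huo, Relation.ReflTransGen.tail huv hvw⟩
  rcases key b hob with hlt | h
  · have := boxNorm_eq_of_mem_innerBoundary hb
    omega
  · exact h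

/-- An open path of the read-out is an open lattice path inside `Λ_n`.
[cite: DuminilCopinRaoufiTassion2019, §3 Lemma 3.2 (the events u ↔ ∂Λ_k inside Λ_n)] -/
theorem pathIn_of_yReach' (hedge : ∀ a b e, edge a b = some e ↔ (zdGraph d).Adj a.1 b.1 ∧ (e : Sym2 (Site d)) = s(a.1, b.1))
    {ω : BondConfig (Site d)} {a b : BoxV d n} (h : YReach edge (fun e => decide (e.1 ∈ ω)) a b) :
    PathIn (openGraph ω) ↑(box d n) a.1 b.1 := by
  refine ⟨a.2, ?_⟩
  unfold YReach at h
  induction h with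
  | refl => exact Relation.ReflTransGen.refl
  | @tail v w _ hvw ih =>
    obtain ⟨hne, _, hy⟩ := (yAdj_readout_iff edge hedge ω v w).1 hvw
    refine Relation.ReflTransGen.tail ih ⟨?_, w.2⟩
    rw [openGraph_adj]
    exact ⟨hy, fun h => hne (Subtype.ext h)⟩

/-- Conversely, for a configuration of lattice edges, an open lattice path inside `Λ_n` is an open path of the read-out.
[cite: DuminilCopinRaoufiTassion2019, §3 Lemma 3.2 (the events u ↔ ∂Λ_k inside Λ_n)] -/
theorem yReach_of_pathIn' (hedge : ∀ a b e, edge a b = some e ↔ (zdGraph d).Adj a.1 b.1 ∧ (e : Sym2 (Site d)) = s(a.1, b.1))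
    {ω : BondConfig (Site d)} (hω : ω ⊆ (zdGraph d).edgeSet) {a b : BoxV d n}
    (h : PathIn (openGraph ω) ↑(box d n) a.1 b.1) : YReach edge (fun e => decide (e.1 ∈ ω)) a b := by
  suffices H : ∀ y : Site d,
      Relation.ReflTransGen (fun u v => (openGraph ω).Adj u v ∧ v ∈ (↑(box d n) : Set (Site d))) a.1 y →
      ∀ hy : y ∈ box d n, YReach edge (fun e => decide (e.1 ∈ ω)) a ⟨y, hy⟩ from H b.1 h.2 b.2
  intro y hy
  induction hy with
  | refl => intro _; exact Relation.ReflTransGen.refl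
  | @tail c e' hac hcd ih =>
    intro he'
    obtain ⟨hadj, _⟩ := hcd
    rw [openGraph_adj] at hadj
    obtain ⟨hmem, hne⟩ := hadj
    have hc : c ∈ box d n := by
      rcases Relation.ReflTransGen.cases_tail hac with h0 | ⟨b', _, hcb⟩
      · rw [h0]; exact a.2
      · exact hcb.2
    have hlat : (zdGraph d).Adj c e' := by
      have := hω hmem
      rwa [SimpleGraph.mem_edgeSet] at this
    exact Relation.ReflTransGen.tail (ih hc)
      ((yAdj_readout_iff edge hedge ω ⟨c, hc⟩ ⟨e', he'⟩).2 ⟨fun h => hne (congrArg Subtype.val h), hlat, hmem⟩)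

/-- `𝟙{0 ↔ ∂Λ_n}` of the read-out implies the one-arm event. [cite: DuminilCopinRaoufiTassion2019, §3 Lemma 3.2 (the event 0 ↔ ∂Λ_n)] -/
theorem mem_siteToBoundary_of_conn' (hedge : ∀ a b e, edge a b = some e ↔ (zdGraph d).Adj a.1 b.1 ∧ (e : Sym2 (Site d)) = s(a.1, b.1))
    {ω : BondConfig (Site d)} (h : Conn edge (origin d n) (bdryTarget d n) (fun e => decide (e.1 ∈ ω))) :
    ω ∈ siteToBoundary d n := by
  obtain ⟨b, hb, hr⟩ := h
  rw [mem_siteToBoundary_iff]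
  exact ⟨b.1, hb, pathIn_of_yReach' edge hedge hr⟩

/-- For configurations of lattice edges the one-arm event is `𝟙{0 ↔ ∂Λ_n}` of the read-out.
[cite: DuminilCopinRaoufiTassion2019, §3 Lemma 3.2 (the event 0 ↔ ∂Λ_n)] -/
theorem conn_of_mem_siteToBoundary' (hedge : ∀ a b e, edge a b = some e ↔ (zdGraph d).Adj a.1 b.1 ∧ (e : Sym2 (Site d)) = s(a.1, b.1))
    {ω : BondConfig (Site d)} (hω : ω ⊆ (zdGraph d).edgeSet) (h : ω ∈ siteToBoundary d n) :
    Conn edge (origin d n) (bdryTarget d n) (fun e => decide (e.1 ∈ ω)) := by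
  rw [mem_siteToBoundary_iff] at h
  obtain ⟨y, hy, hpath⟩ := h
  have hyb : y ∈ box d n := (mem_innerBoundary_iff.1 hy).1
  exact ⟨⟨y, hyb⟩, hy, yReach_of_pathIn' edge hedge hω (a := origin d n) (b := ⟨y, hyb⟩) hpath⟩

/-- REVEALMENT GEOMETRY: for a configuration of lattice edges, "`a` joined to `∂Λ_k` inside `Λ_n`" (read-out) implies the
translated arm event `armEvent a |k − ‖a‖_∞|` (the open path leaves `a + Λ_{|k−‖a‖|−1}`).
[cite: DuminilCopinRaoufiTassion2019, §3 proof of Lemma 3.2 (∑_k μ[u↔∂Λ_k] ≤ ∑_k μ[u ↔ ∂Λ_{|k−d(u,0)|}(u)])] -/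
theorem armEvent_of_seedConn' (hedge : ∀ a b e, edge a b = some e ↔ (zdGraph d).Adj a.1 b.1 ∧ (e : Sym2 (Site d)) = s(a.1, b.1))
    (hd : 1 ≤ d) {ω : BondConfig (Site d)} (hω : ω ⊆ (zdGraph d).edgeSet) {k : ℕ} {a : BoxV d n}
    (h : SeedConn edge (sphereSeed d n k) (fun e => decide (e.1 ∈ ω)) a) :
    ω ∈ armEvent a.1 (Nat.dist k (boxNorm a.1)) := by
  obtain ⟨u, hu, hua⟩ := h
  have hau : YReach edge (fun e => decide (e.1 ∈ ω)) a u := yReach_symm (edge_symm' edge hedge) hua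
  have hpath := pathIn_of_yReach' edge hedge hau
  refine armEvent_of_pathIn hω hpath (not_mem_box_or_mem_innerBoundary hd ?_)
  have h1 := dist_boxNorm_le u.1 a.1
  change boxNorm u.1 = k at hu
  rw [hu] at h1
  exact h1

end Incidence

end MonotonicOSSS

end Summit.CriticalPhenomena.PercolationContinuityZ3.Theorems.FK
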